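import Literature.Algebra.Homology.HopfTraceFormulaInt
import Mathlib.Algebra.Field.ZMod
import HarnessLib

/-!
# The Lefschetz number with arbitrary field coefficients is the image of the integral one

Layer `Literature/Algebra/Homology` (pure algebra over Mathlib; proved theorems only, 0 definitions, 0 named facts, no instances, no notation).
Rows `HomologyBaseChangeFlat` ∕ `HopfTraceFormulaInt` express the Lefschetz number `Λ(K ⊗_R φ)` (row `LefschetzNumber`) through the
`R`-homology only for `f : R →+* K` FLAT and INJECTIVE, because they pass through `K ⊗_R Hₙ(C)`. For a complex of finitely generated FREE
modules the chain level is available for ANY ring map (row `HopfTraceFormulaBaseChange`'s `map_finsum_χ_smul_trace_f`), and row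
`HopfTraceFormulaInt` identifies the chain-level super-trace with `Σᶠ χ(n) • tr_R H̄ₙ(φ)` (`H̄ₙ(φ)` = the endomorphism of `Hₙ(C) ⧸ torsion`). Hence:

* `lefschetzNumber_extendScalars_eq_map_finsum_trace_mapQ_of_pid` — over a principal ideal domain `R` (with one auxiliary flat injective
  `f₀ : R →+* K₀`, e.g. `R ⊆ Frac R`), for EVERY ring map `f : R →+* K` to a field: **`Λ(K ⊗_R φ) = f(Σᶠ χ(n) • tr_R H̄ₙ(φ))`**;
* **`Int.lefschetzNumber_extendScalars_eq_cast`** — `R = ℤ`, every field `K` (any characteristic): `Λ(K ⊗_ℤ φ) = ↑Λ_ℤ(φ)` with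
  `Λ_ℤ(φ) = Σᶠ χ(n) • tr_ℤ(H̄ₙ(φ) on Hₙ(C) ⁄ torsion)` the integer of Hatcher's Thm. 2C.3 (spelled with Mathlib's `Submodule.Quotient.module`
  as in row `HopfTraceFormulaInt`); corollaries `Int.lefschetzNumber_extendScalars_zmod_eq_zero_iff` (**`Λ(𝔽_p ⊗ φ) = 0 ↔ p ∣ Λ_ℤ(φ)`** — the Lefschetz
  number mod `p` is the reduction of the integral one) and `Int.lefschetzNumber_extendScalars_eq_zero_iff` (characteristic `0`:
  `Λ(K ⊗ φ) = 0 ↔ Λ_ℤ(φ) = 0`, so vanishing does not depend on the characteristic-zero field).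

`[(ModuleCat.extendScalars _).Additive]` instance HYPOTHESES as in rows `HopfTraceFormulaBaseChange` ∕ `HomologyBaseChangeFlat` ∕ `HopfTraceFormulaInt`.
Library only (cell `pub-hodge-ring2`, count-neutral); proves nothing about any crux, route or conjecture.

## References

* A. Hatcher, *Algebraic Topology* (2002), §2.C (Lefschetz number, Thm. 2C.3), §3.A (coefficients). [HatcherAT2002]
* K. S. Brown, *Cohomology of Groups* (1982), IX §§6–7 (Euler characteristics ∕ Lefschetz numbers and coefficients). [Brown1982]
* E. H. Spanier, *Algebraic Topology* (1981), Ch. 4 §7. [Spanier1981]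
-/

open CategoryTheory CategoryTheory.Limits

universe u u' w

namespace Literature.Algebra.Homology.HopfTrace

open Submodule (torsion)
open TraceBaseChangeTorsion (torsion_le_comap)

/-- **`Λ(K ⊗_R φ) = f(Σᶠ χ(n) • tr_R H̄ₙ(φ))` for EVERY ring map `f` to a field** (no flatness, no injectivity), over a principal ideal domain `R`
admitting a flat injective `f₀ : R →+* K₀` into some field, for an endomorphism `φ` of a complex of finitely generated free `R`-modules with
finitely many non-zero ranks. [cite: HatcherAT2002, Thm. 2C.3] [cite: Brown1982, IX §7] -/
theorem lefschetzNumber_extendScalars_eq_map_finsum_trace_mapQ_of_pid {R K₀ : Type u} {K : Type u'} [CommRing R] [IsDomain R]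
    [IsPrincipalIdealRing R] [Field K₀] [Field K] (f₀ : R →+* K₀) (f : R →+* K) [(ModuleCat.extendScalars.{u, u, u} f₀).Additive]
    [(ModuleCat.extendScalars.{u, u', u} f).Additive] {ι : Type w} {c : ComplexShape ι} [c.EulerCharSigns]
    (C : HomologicalComplex (ModuleCat.{u} R) c) (φ : C ⟶ C) [∀ i, Module.Free R (C.X i)] [∀ i, Module.Finite R (C.X i)]
    (hf₀ : f₀.Flat) (hinj₀ : Function.Injective f₀) (hC : (GradedObject.finrankSupport C.X).Finite) :
    Lefschetz.lefschetzNumber (((ModuleCat.extendScalars f).mapHomologicalComplex c).map φ) =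
      f (∑ᶠ n, (c.χ n : ℤ) • LinearMap.trace R _ ((torsion R (C.homology n)).mapQ (torsion R (C.homology n))
        (HomologicalComplex.homologyMap φ n).hom (torsion_le_comap _))) := by
  rw [← finsum_χ_smul_trace_f_eq_finsum_χ_smul_trace_homology_mapQ f₀ C φ hf₀ hinj₀ hC]
  exact (map_finsum_χ_smul_trace_f f C φ hC).symm

namespace Int

variable {K : Type u'} [Field K] {ι : Type w} {c : ComplexShape ι} [c.EulerCharSigns] (C : HomologicalComplex (ModuleCat.{0} ℤ) c)
  (φ : C ⟶ C) [(ModuleCat.extendScalars.{0, 0, 0} (Int.castRingHom ℚ)).Additive]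
  [(ModuleCat.extendScalars.{0, u', 0} (Int.castRingHom K)).Additive] [∀ i, Module.Free ℤ (C.X i)] [∀ i, Module.Finite ℤ (C.X i)]

/-- **`Λ(K ⊗_ℤ φ) = ↑Λ_ℤ(φ)` for EVERY field `K`**: the Lefschetz number with coefficients in `K` of an endomorphism of a complex of finitely generated
free abelian groups (finitely many non-zero ranks) is the cast of the integer `Λ_ℤ(φ) = Σᶠ χ(n) • tr_ℤ(H̄ₙ(φ) on Hₙ(C) ⁄ torsion)`.
[cite: HatcherAT2002, Thm. 2C.3] [cite: Brown1982, IX §7] -/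
theorem lefschetzNumber_extendScalars_eq_cast (hC : (GradedObject.finrankSupport C.X).Finite) :
    Lefschetz.lefschetzNumber (((ModuleCat.extendScalars (Int.castRingHom K)).mapHomologicalComplex c).map φ) =
      ((∑ᶠ n, (c.χ n : ℤ) • @LinearMap.trace ℤ _ (C.homology n ⧸ torsion ℤ (C.homology n)) _ (Submodule.Quotient.module _)
        ((torsion ℤ (C.homology n)).mapQ (torsion ℤ (C.homology n)) (HomologicalComplex.homologyMap φ n).hom (torsion_le_comap _)) : ℤ) : K) := by
  rw [← finsum_χ_smul_trace_f_eq C φ hC]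
  exact (map_finsum_χ_smul_trace_f (Int.castRingHom K) C φ hC).symm

/-- **Characteristic `0`: `Λ(K ⊗_ℤ φ) = 0 ↔ Λ_ℤ(φ) = 0`** — the vanishing of the Lefschetz number does not depend on the characteristic-zero field.
[cite: HatcherAT2002, §2.C] -/
theorem lefschetzNumber_extendScalars_eq_zero_iff [CharZero K] (hC : (GradedObject.finrankSupport C.X).Finite) :
    Lefschetz.lefschetzNumber (((ModuleCat.extendScalars (Int.castRingHom K)).mapHomologicalComplex c).map φ) = 0 ↔
      ∑ᶠ n, (c.χ n : ℤ) • @LinearMap.trace ℤ _ (C.homology n ⧸ torsion ℤ (C.homology n)) _ (Submodule.Quotient.module _)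
        ((torsion ℤ (C.homology n)).mapQ (torsion ℤ (C.homology n)) (HomologicalComplex.homologyMap φ n).hom (torsion_le_comap _)) = 0 := by
  rw [lefschetzNumber_extendScalars_eq_cast C φ hC, Int.cast_eq_zero]

end Int

/-- **The Lefschetz number mod `p` is the reduction of the integral one**: `Λ(𝔽_p ⊗_ℤ φ) = 0 ↔ p ∣ Λ_ℤ(φ)`.
[cite: HatcherAT2002, §3.A] [cite: Brown1982, IX §7] -/
theorem Int.lefschetzNumber_extendScalars_zmod_eq_zero_iff (p : ℕ) [Fact p.Prime] {ι : Type w} {c : ComplexShape ι} [c.EulerCharSigns]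
    (C : HomologicalComplex (ModuleCat.{0} ℤ) c) (φ : C ⟶ C) [(ModuleCat.extendScalars.{0, 0, 0} (Int.castRingHom ℚ)).Additive]
    [(ModuleCat.extendScalars.{0, 0, 0} (Int.castRingHom (ZMod p))).Additive] [∀ i, Module.Free ℤ (C.X i)] [∀ i, Module.Finite ℤ (C.X i)]
    (hC : (GradedObject.finrankSupport C.X).Finite) :
    Lefschetz.lefschetzNumber (((ModuleCat.extendScalars (Int.castRingHom (ZMod p))).mapHomologicalComplex c).map φ) = 0 ↔
      (p : ℤ) ∣ ∑ᶠ n, (c.χ n : ℤ) • @LinearMap.trace ℤ _ (C.homology n ⧸ torsion ℤ (C.homology n)) _ (Submodule.Quotient.module _)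
        ((torsion ℤ (C.homology n)).mapQ (torsion ℤ (C.homology n)) (HomologicalComplex.homologyMap φ n).hom (torsion_le_comap _)) := by
  rw [Int.lefschetzNumber_extendScalars_eq_cast C φ hC, ZMod.intCast_zmod_eq_zero_iff_dvd]

end Literature.Algebra.Homology.HopfTrace
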